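import Summits.CriticalPhenomena.SAWScalingLimit.Theorems.SAWRenewalTightnessTubeLowerBoundCornerStaircaseHelpers

/-!
# Crux `TubeLowerBound` (stmt-CriticalPhenomena-4730), line `Sketch` (= lasso-repair-poly-hw): the lasso inequality

Stub `stub_lassoGluing` (S2 of the checked skeleton of the line `Sketch` = `lasso-repair-poly-hw`): the
**two-piece lasso inequality**.  For confining predicates `P ⊆ R`, `e₁ + Q ⊆ R` (NO separation hypothesis,
contrast `CornerStaircase.tubeMass_concat`) the confined two-point partial sums at `x_c` satisfy
`T(P,e₁,M) · T(Q,e₂,N) ≤ (M+1) · A(M) · A(N) · T(R, e₁+e₂, M+N)`, where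
`T(P,e,N) = Σ_{n ≤ N} Σ_{ω ∈ sawFun 2 n e, ∀ i ≤ n, P (ω i)} x_c^n` and `A(M) = Σ_{k ≤ M} c_k x_c^k`.

The map.  For a `P`-confined self-avoiding `ω : 0 → e₁` of length `m ≤ M` and a `Q`-confined self-avoiding
`υ : 0 → e₂` of length `n ≤ N`, let `t ≤ m` be the FIRST time with `ω t ∈ {e₁ + υ j : j ≤ n}` (it exists:
`ω m = e₁ = e₁ + υ 0`) and `s ≤ n` an index with `e₁ + υ s = ω t`.  The lasso walk `γ := ω[0..t]` followed by
`e₁ + υ[s..n]` is self-avoiding because `t` is minimal, `R`-confined, of length `t + (n − s) ≤ M + N`, from `0`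
to `e₁ + e₂` (`lasso_mem_sawFun`).  Together with the jump time `t ≤ M`, the re-based tail
`k ↦ ω (t + k) − ω t ∈ saws 2 (m − t)` (`tail_mem_saws`) and the head `υ[0..s] ∈ saws 2 s` (`head_mem_saws`)
it determines `(m, ω, n, υ)`, and `x_c^m x_c^n = x_c^{m−t} x_c^{s} x_c^{t+(n−s)}`; summing over the image of
this injection inside `{t ≤ M} × (Σ_{a ≤ M} saws 2 a) × (Σ_{b ≤ N} saws 2 b) × (Σ_{L ≤ M+N} F_R(L))` gives the
bound (`rhs_eq_sum`, `lasso_bound`); the first hitting time is a `Nat.find` (`stub_lassoGluing`).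
-/

noncomputable section

namespace Summit.CriticalPhenomena.SAWScalingLimit.Theorems.TubeLowerBound.LassoRepair

open scoped BigOperators Classical
open Literature.Probability.LatticeModels
open Literature.Probability.RandomPlanarGeometry Literature.Probability.RandomPlanarGeometry.SAW

/-! ### The three pieces of the lasso decomposition -/

/-- The re-based tail `k ↦ ω (t + k) − ω t` of a self-avoiding walk of length `m` after a time `t ≤ m` is a
self-avoiding walk of length `m − t` from the origin. -/
theorem tail_mem_saws {m t : ℕ} {e₁ : Site 2} {ω : ℕ → Site 2} (hω : ω ∈ Zd.sawFun 2 m e₁)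
    (ht : t ≤ m) : (fun k => ω (t + k) - ω t) ∈ Zd.saws 2 (m - t) := by
  obtain ⟨-, hend, hadj, hinj⟩ := Zd.mem_sawFun.1 hω
  refine Zd.mem_saws.2 ⟨?_, fun k hk => ?_, fun k hk => ?_, fun i hi j hj hij => ?_⟩
  · show ω (t + 0) - ω t = 0
    rw [add_zero, sub_self]
  · show ω (t + k) - ω t = ω (t + (m - t)) - ω t
    rw [hend (t + k) (by omega), hend (t + (m - t)) (by omega)]
  · show (zdGraph 2).Adj (ω (t + k) - ω t) (ω (t + (k + 1)) - ω t)
    rw [Zd.zdGraph_adj_sub_right, ← add_assoc]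
    exact hadj (t + k) (by omega)
  · simp only [Set.mem_setOf_eq] at hi hj
    have hij' : ω (t + i) - ω t = ω (t + j) - ω t := hij
    have := hinj (show t + i ≤ m by omega) (show t + j ≤ m by omega) (sub_left_inj.1 hij')
    omega

/-- The head `j ↦ υ (min j s)` of a self-avoiding walk of length `n` up to a time `s ≤ n` is a self-avoiding
walk of length `s` from the origin. -/
theorem head_mem_saws {n s : ℕ} {e₂ : Site 2} {υ : ℕ → Site 2} (hυ : υ ∈ Zd.sawFun 2 n e₂)
    (hs : s ≤ n) : (fun j => υ (min j s)) ∈ Zd.saws 2 s := by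
  obtain ⟨h0, -, hadj, hinj⟩ := Zd.mem_sawFun.1 hυ
  refine Zd.mem_saws.2 ⟨?_, fun j hj => ?_, fun j hj => ?_, fun i hi j hj hij => ?_⟩
  · show υ (min 0 s) = 0
    rw [min_eq_left (Nat.zero_le s), h0]
  · show υ (min j s) = υ (min s s)
    rw [min_eq_right hj, min_self]
  · show (zdGraph 2).Adj (υ (min j s)) (υ (min (j + 1) s))
    rw [min_eq_left hj.le, min_eq_left (Nat.succ_le_of_lt hj)]
    exact hadj j (by omega)
  · simp only [Set.mem_setOf_eq] at hi hj
    have hij' : υ (min i s) = υ (min j s) := hij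
    rw [min_eq_left hi, min_eq_left hj] at hij'
    exact hinj (show i ≤ n by omega) (show j ≤ n by omega) hij'

/-- **The lasso walk.**  If `ω : 0 → e₁` (length `m`) and `υ : 0 → e₂` (length `n`) are self-avoiding,
`t ≤ m`, `s ≤ n`, `ω t = e₁ + υ s`, and `ω[0..t)` misses the translate `e₁ + υ[0..n]`, then `ω[0..t]` followed by
`e₁ + υ[s..n]` is a self-avoiding walk `0 → e₁ + e₂` of length `t + (n − s)`. -/
theorem lasso_mem_sawFun {m n t s : ℕ} {e₁ e₂ : Site 2} {ω υ : ℕ → Site 2}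
    (hω : ω ∈ Zd.sawFun 2 m e₁) (hυ : υ ∈ Zd.sawFun 2 n e₂) (ht : t ≤ m) (hs : s ≤ n)
    (hts : ω t = e₁ + υ s) (hmin : ∀ i < t, ∀ j ≤ n, ω i ≠ e₁ + υ j) :
    (fun i => if i ≤ t then ω i else e₁ + υ (s + (i - t))) ∈
      Zd.sawFun 2 (t + (n - s)) (e₁ + e₂) := by
  obtain ⟨hω0, -, hωadj, hωinj⟩ := Zd.mem_sawFun.1 hω
  obtain ⟨-, hυend, hυadj, hυinj⟩ := Zd.mem_sawFun.1 hυ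
  refine Zd.mem_sawFun.2 ⟨?_, fun i hi => ?_, fun i hi => ?_, fun i hi j hj hij => ?_⟩
  · show (if 0 ≤ t then ω 0 else e₁ + υ (s + (0 - t))) = 0
    rw [if_pos (Nat.zero_le t), hω0]
  · -- frozen at `e₁ + e₂` from time `t + (n - s)` on
    show (if i ≤ t then ω i else e₁ + υ (s + (i - t))) = e₁ + e₂
    by_cases h : i ≤ t
    · have hsn : s = n := by omega
      rw [if_pos h, show i = t by omega, hts, hsn, hυend n le_rfl]
    · rw [if_neg h, hυend (s + (i - t)) (by omega)]
  · -- nearest-neighbour steps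
    show (zdGraph 2).Adj (if i ≤ t then ω i else e₁ + υ (s + (i - t)))
      (if i + 1 ≤ t then ω (i + 1) else e₁ + υ (s + (i + 1 - t)))
    by_cases h : i + 1 ≤ t
    · rw [if_pos h, if_pos (show i ≤ t by omega)]
      exact hωadj i (by omega)
    · by_cases h' : i ≤ t
      · rw [if_pos h', if_neg h, show i = t by omega, hts, Nat.add_sub_cancel_left,
          add_comm e₁ (υ s), add_comm e₁ (υ (s + 1)), Zd.zdGraph_adj_add_right]
        exact hυadj s (by omega)
      · rw [if_neg h', if_neg h, show s + (i + 1 - t) = s + (i - t) + 1 by omega,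
          add_comm e₁ (υ (s + (i - t))), add_comm e₁ (υ (s + (i - t) + 1)),
          Zd.zdGraph_adj_add_right]
        exact hυadj (s + (i - t)) (by omega)
  · -- self-avoiding, by minimality of `t`
    simp only [Set.mem_setOf_eq] at hi hj
    have hij' : (if i ≤ t then ω i else e₁ + υ (s + (i - t))) =
        (if j ≤ t then ω j else e₁ + υ (s + (j - t))) := hij
    by_cases h1 : i ≤ t <;> by_cases h2 : j ≤ t
    · rw [if_pos h1, if_pos h2] at hij'
      exact hωinj (show i ≤ m by omega) (show j ≤ m by omega) hij'
    · rw [if_pos h1, if_neg h2] at hij'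
      by_cases h3 : i < t
      · exact absurd hij' (hmin i h3 _ (by omega))
      · rw [show i = t by omega, hts, add_right_inj] at hij'
        have := hυinj (show s ≤ n by omega) (show s + (j - t) ≤ n by omega) hij'
        omega
    · rw [if_neg h1, if_pos h2] at hij'
      by_cases h3 : j < t
      · exact absurd hij'.symm (hmin j h3 _ (by omega))
      · rw [show j = t by omega, hts, add_right_inj] at hij'
        have := hυinj (show s + (i - t) ≤ n by omega) (show s ≤ n by omega) hij'
        omega
    · rw [if_neg h1, if_neg h2, add_right_inj] at hij'
      have := hυinj (show s + (i - t) ≤ n by omega) (show s + (j - t) ≤ n by omega) hij'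
      omega

/-! ### The bookkeeping: both sides as sums over product finsets -/

/-- The right-hand side `(M+1) · A(M) · A(N) · T` of the lasso inequality as one sum over
`{t ≤ M} × (Σ_{a ≤ M} saws 2 a) × (Σ_{b ≤ N} saws 2 b) × (Σ_{L ≤ M+N} H L)` of the weights
`x_c^a · x_c^b · x_c^L` (`#saws 2 k = c_k`). -/
theorem rhs_eq_sum (H : ℕ → Finset (ℕ → Site 2)) (M N : ℕ) :
    ((M : ℝ) + 1) * (∑ k ∈ Finset.range (M + 1), (Zd.count 2 k : ℝ) * criticalFugacity ^ k) *
        (∑ k ∈ Finset.range (N + 1), (Zd.count 2 k : ℝ) * criticalFugacity ^ k) *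
        ∑ k ∈ Finset.range (M + N + 1), ∑ _γ ∈ H k, criticalFugacity ^ k =
      ∑ v ∈ ((Finset.range (M + 1) ×ˢ (Finset.range (M + 1)).sigma (fun a => Zd.saws 2 a)) ×ˢ
          (Finset.range (N + 1)).sigma (fun b => Zd.saws 2 b)) ×ˢ (Finset.range (M + N + 1)).sigma H,
        criticalFugacity ^ v.1.1.2.1 * criticalFugacity ^ v.1.2.1 * criticalFugacity ^ v.2.1 := by
  have hA : ∀ K : ℕ, (∑ k ∈ Finset.range (K + 1), (Zd.count 2 k : ℝ) * criticalFugacity ^ k) =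
      ∑ p ∈ (Finset.range (K + 1)).sigma (fun a => Zd.saws 2 a), criticalFugacity ^ p.1 := by
    intro K
    have e : (∑ a ∈ Finset.range (K + 1), ∑ _τ ∈ Zd.saws 2 a, criticalFugacity ^ a) =
        ∑ p ∈ (Finset.range (K + 1)).sigma (fun a => Zd.saws 2 a), criticalFugacity ^ p.1 :=
      Finset.sum_sigma' _ _ _
    rw [← e]
    refine Finset.sum_congr rfl fun a _ => ?_
    rw [Finset.sum_const, nsmul_eq_mul, Zd.card_saws]
  have eT : (∑ k ∈ Finset.range (M + N + 1), ∑ _γ ∈ H k, criticalFugacity ^ k) =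
      ∑ p ∈ (Finset.range (M + N + 1)).sigma H, criticalFugacity ^ p.1 := Finset.sum_sigma' _ _ _
  have key : ∀ SA SB ST : ℝ, ((M : ℝ) + 1) * SA * SB * ST =
      ∑ _t ∈ Finset.range (M + 1), SA * SB * ST := by
    intro SA SB ST
    rw [Finset.sum_const, Finset.card_range, nsmul_eq_mul]
    push_cast
    ring
  rw [hA M, hA N, eT, Finset.sum_product, Finset.sum_product, Finset.sum_product, key]
  refine Finset.sum_congr rfl fun t _ => ?_
  rw [Finset.sum_mul_sum, Finset.sum_mul]
  refine Finset.sum_congr rfl fun a _ => ?_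
  rw [Finset.sum_mul]
  refine Finset.sum_congr rfl fun q _ => ?_
  rw [Finset.mul_sum]

/-- **The lasso bound, given the hitting data.**  If `tOf`, `sOf` pick, for every pair of walks, a time
`t ≤ m` on the first and an index `s ≤ n` on the second such that (for genuine self-avoiding walks `ω : 0 → e₁`,
`υ : 0 → e₂`) `ω t = e₁ + υ s` and `ω[0..t)` misses `e₁ + υ[0..n]`, then
`T(P,e₁,M) · T(Q,e₂,N) ≤ (M+1) · A(M) · A(N) · T(R, e₁+e₂, M+N)` whenever `P ⊆ R` and `e₁ + Q ⊆ R`: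
the map `(m, ω, n, υ) ↦ (t, tail, head, lasso walk)` is a weight-preserving injection. -/
theorem lasso_bound {P Q R : Site 2 → Prop} [DecidablePred P] [DecidablePred Q] [DecidablePred R]
    {e₁ e₂ : Site 2} (hP : ∀ p, P p → R p) (hQ : ∀ q, Q q → R (e₁ + q)) (M N : ℕ)
    (tOf sOf : (Σ _ : ℕ, (ℕ → Site 2)) × (Σ _ : ℕ, (ℕ → Site 2)) → ℕ)
    (ht_le : ∀ (m : ℕ) (ω : ℕ → Site 2) (n : ℕ) (υ : ℕ → Site 2), tOf (⟨m, ω⟩, ⟨n, υ⟩) ≤ m)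
    (hs_le : ∀ (m : ℕ) (ω : ℕ → Site 2) (n : ℕ) (υ : ℕ → Site 2), sOf (⟨m, ω⟩, ⟨n, υ⟩) ≤ n)
    (hts : ∀ (m : ℕ) (ω : ℕ → Site 2) (n : ℕ) (υ : ℕ → Site 2), ω ∈ Zd.sawFun 2 m e₁ →
      υ ∈ Zd.sawFun 2 n e₂ → ω (tOf (⟨m, ω⟩, ⟨n, υ⟩)) = e₁ + υ (sOf (⟨m, ω⟩, ⟨n, υ⟩)))
    (hmin : ∀ (m : ℕ) (ω : ℕ → Site 2) (n : ℕ) (υ : ℕ → Site 2),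
      ∀ i < tOf (⟨m, ω⟩, ⟨n, υ⟩), ∀ j ≤ n, ω i ≠ e₁ + υ j) :
    (∑ m ∈ Finset.range (M + 1),
        ∑ _ω ∈ (Zd.sawFun 2 m e₁).filter (fun ω => ∀ i ≤ m, P (ω i)), criticalFugacity ^ m) *
      (∑ n ∈ Finset.range (N + 1),
        ∑ _ω ∈ (Zd.sawFun 2 n e₂).filter (fun ω => ∀ i ≤ n, Q (ω i)), criticalFugacity ^ n) ≤
      ((M : ℝ) + 1) * (∑ k ∈ Finset.range (M + 1), (Zd.count 2 k : ℝ) * criticalFugacity ^ k) *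
        (∑ k ∈ Finset.range (N + 1), (Zd.count 2 k : ℝ) * criticalFugacity ^ k) *
        ∑ k ∈ Finset.range (M + N + 1),
          ∑ _ω ∈ (Zd.sawFun 2 k (e₁ + e₂)).filter (fun ω => ∀ i ≤ k, R (ω i)), criticalFugacity ^ k := by
  set A := (Finset.range (M + 1)).sigma
    (fun m => (Zd.sawFun 2 m e₁).filter (fun ω => ∀ i ≤ m, P (ω i))) with hA
  set B := (Finset.range (N + 1)).sigma
    (fun n => (Zd.sawFun 2 n e₂).filter (fun ω => ∀ i ≤ n, Q (ω i))) with hB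
  have eA : (∑ m ∈ Finset.range (M + 1),
      ∑ _ω ∈ (Zd.sawFun 2 m e₁).filter (fun ω => ∀ i ≤ m, P (ω i)), criticalFugacity ^ m) =
      ∑ p ∈ A, criticalFugacity ^ p.1 := Finset.sum_sigma' _ _ _
  have eB : (∑ n ∈ Finset.range (N + 1),
      ∑ _ω ∈ (Zd.sawFun 2 n e₂).filter (fun ω => ∀ i ≤ n, Q (ω i)), criticalFugacity ^ n) =
      ∑ p ∈ B, criticalFugacity ^ p.1 := Finset.sum_sigma' _ _ _
  rw [eA, eB, Finset.sum_mul_sum, ← Finset.sum_product']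
  refine le_of_le_of_eq ?_
    (rhs_eq_sum (fun k => (Zd.sawFun 2 k (e₁ + e₂)).filter (fun ω => ∀ i ≤ k, R (ω i))) M N).symm
  -- the map `(m, ω, n, υ) ↦ (t, (m - t, tail), (s, head), (t + (n - s), lasso walk))`
  set g : (Σ _ : ℕ, (ℕ → Site 2)) × (Σ _ : ℕ, (ℕ → Site 2)) →
      ((ℕ × (Σ _ : ℕ, (ℕ → Site 2))) × (Σ _ : ℕ, (ℕ → Site 2))) × (Σ _ : ℕ, (ℕ → Site 2)) :=
    fun z => (((tOf z, ⟨z.1.1 - tOf z, fun k => z.1.2 (tOf z + k) - z.1.2 (tOf z)⟩),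
      ⟨sOf z, fun j => z.2.2 (min j (sOf z))⟩),
      ⟨tOf z + (z.2.1 - sOf z),
        fun i => if i ≤ tOf z then z.1.2 i else e₁ + z.2.2 (sOf z + (i - tOf z))⟩) with hg
  -- it maps pairs of confined walks into the box of the right-hand side
  have hmaps : ∀ z ∈ A ×ˢ B, g z ∈
      ((Finset.range (M + 1) ×ˢ (Finset.range (M + 1)).sigma (fun a => Zd.saws 2 a)) ×ˢ
        (Finset.range (N + 1)).sigma (fun b => Zd.saws 2 b)) ×ˢ (Finset.range (M + N + 1)).sigma
          (fun k => (Zd.sawFun 2 k (e₁ + e₂)).filter (fun ω => ∀ i ≤ k, R (ω i))) := by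
    rintro ⟨⟨m, ω⟩, ⟨n, υ⟩⟩ hz
    simp only [hA, hB, Finset.mem_product, Finset.mem_sigma, Finset.mem_range,
      Finset.mem_filter] at hz
    obtain ⟨⟨hm, hω, hPω⟩, hn, hυ, hQυ⟩ := hz
    have ht := ht_le m ω n υ
    have hs := hs_le m ω n υ
    have he := hts m ω n υ hω hυ
    have hmn := hmin m ω n υ
    simp only [hg, Finset.mem_product, Finset.mem_sigma, Finset.mem_range, Finset.mem_filter]
    refine ⟨⟨⟨by omega, by omega, tail_mem_saws hω ht⟩, by omega, head_mem_saws hυ hs⟩, by omega,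
      lasso_mem_sawFun hω hυ ht hs he hmn, fun i hi => ?_⟩
    split_ifs with h
    · exact hP _ (hPω i (by omega))
    · exact hQ _ (hQυ _ (by omega))
  -- it is injective
  have hinj : Set.InjOn g ↑(A ×ˢ B) := by
    rintro ⟨⟨m, ω⟩, ⟨n, υ⟩⟩ - ⟨⟨m', ω'⟩, ⟨n', υ'⟩⟩ - h
    have ht := ht_le m ω n υ
    have hs := hs_le m ω n υ
    have ht' := ht_le m' ω' n' υ'
    have hs' := hs_le m' ω' n' υ'
    simp only [hg, Prod.mk.injEq, Sigma.mk.inj_iff, heq_eq_eq] at h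
    obtain ⟨⟨⟨htt, hmm, htail⟩, hss, hhead⟩, hL, hγ⟩ := h
    set t := tOf (⟨m, ω⟩, ⟨n, υ⟩) with htdef
    set s := sOf (⟨m, ω⟩, ⟨n, υ⟩) with hsdef
    rw [← htt] at hmm htail hL hγ ht'
    rw [← hss] at hhead hL hγ hs'
    have hm : m = m' := by omega
    have hn : n = n' := by omega
    have h0 : ω t = ω' t := by simpa using congrFun hγ t
    have heω : ω = ω' := by
      funext i
      by_cases hi : i ≤ t
      · simpa [hi] using congrFun hγ i
      · have h1 := congrFun htail (i - t)
        have h2 : t + (i - t) = i := by omega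
        simp only [h2, h0, sub_left_inj] at h1
        exact h1
    have heυ : υ = υ' := by
      funext j
      by_cases hj : j ≤ s
      · simpa [min_eq_left hj] using congrFun hhead j
      · have h1 := congrFun hγ (t + (j - s))
        have h2 : ¬ t + (j - s) ≤ t := by omega
        have h3 : s + (t + (j - s) - t) = j := by omega
        simp only [if_neg h2, h3, add_right_inj] at h1
        exact h1
    subst hm hn heω heυ
    rfl
  -- and it preserves the weights
  have hw : ∀ z : (Σ _ : ℕ, (ℕ → Site 2)) × (Σ _ : ℕ, (ℕ → Site 2)),
      criticalFugacity ^ z.1.1 * criticalFugacity ^ z.2.1 =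
        criticalFugacity ^ (g z).1.1.2.1 * criticalFugacity ^ (g z).1.2.1 *
          criticalFugacity ^ (g z).2.1 := by
    rintro ⟨⟨m, ω⟩, ⟨n, υ⟩⟩
    have ht := ht_le m ω n υ
    have hs := hs_le m ω n υ
    simp only [hg, ← pow_add]
    congr 1
    omega
  calc ∑ z ∈ A ×ˢ B, criticalFugacity ^ z.1.1 * criticalFugacity ^ z.2.1
      = ∑ z ∈ A ×ˢ B, (criticalFugacity ^ (g z).1.1.2.1 * criticalFugacity ^ (g z).1.2.1 *
          criticalFugacity ^ (g z).2.1) := Finset.sum_congr rfl fun z _ => hw z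
    _ = ∑ v ∈ (A ×ˢ B).image g, (criticalFugacity ^ v.1.1.2.1 * criticalFugacity ^ v.1.2.1 *
          criticalFugacity ^ v.2.1) :=
        (Finset.sum_image (f := fun v => criticalFugacity ^ v.1.1.2.1 * criticalFugacity ^ v.1.2.1 *
          criticalFugacity ^ v.2.1) hinj).symm
    _ ≤ _ := Finset.sum_le_sum_of_subset_of_nonneg (Finset.image_subset_iff.2 hmaps) fun _ _ _ =>
          mul_nonneg (mul_nonneg (pow_nonneg criticalFugacity_pos.le _)
            (pow_nonneg criticalFugacity_pos.le _)) (pow_nonneg criticalFugacity_pos.le _)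

/-! ### The stub -/

/-- **S2 `stub_lassoGluing`** — the TWO-PIECE LASSO INEQUALITY.  For predicates `P ⊆ R` and `e₁ + Q ⊆ R`
(no separation assumed) the confined two-point partial sums satisfy
`T(P,e₁,M) · T(Q,e₂,N) ≤ (M+1) · A(M) · A(N) · T(R, e₁+e₂, M+N)` with `A(M) = Σ_{k ≤ M} c_k x_c^k`: follow the
first walk to its FIRST vertex on the translate of the second (a `Nat.find`), then the second to its end; the
fibre over an output is indexed by the jump time `t ≤ M` and the two discarded self-avoiding pieces. -/
theorem stub_lassoGluing :
    ∀ (P Q R : Site 2 → Prop) [DecidablePred P] [DecidablePred Q] [DecidablePred R]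
      (e₁ e₂ e : Site 2), e₁ + e₂ = e → (∀ p, P p → R p) → (∀ q, Q q → R (e₁ + q)) → ∀ (M N : ℕ),
      (∑ m ∈ Finset.range (M + 1),
          ∑ _ω ∈ (Zd.sawFun 2 m e₁).filter (fun ω => ∀ i ≤ m, P (ω i)), criticalFugacity ^ m) *
        (∑ n ∈ Finset.range (N + 1),
          ∑ _ω ∈ (Zd.sawFun 2 n e₂).filter (fun ω => ∀ i ≤ n, Q (ω i)), criticalFugacity ^ n) ≤
      ((M : ℝ) + 1) * (∑ k ∈ Finset.range (M + 1), (Zd.count 2 k : ℝ) * criticalFugacity ^ k) *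
        (∑ k ∈ Finset.range (N + 1), (Zd.count 2 k : ℝ) * criticalFugacity ^ k) *
        ∑ k ∈ Finset.range (M + N + 1),
          ∑ _ω ∈ (Zd.sawFun 2 k e).filter (fun ω => ∀ i ≤ k, R (ω i)), criticalFugacity ^ k := by
  intro P Q R _ _ _ e₁ e₂ e he hP hQ M N
  subst he
  -- the first hitting time `t` of the translate `e₁ + υ[0..n]` by `ω` (capped at `m`)
  obtain ⟨tOf, ht_le, hmin, hspec⟩ :
      ∃ tOf : (Σ _ : ℕ, (ℕ → Site 2)) × (Σ _ : ℕ, (ℕ → Site 2)) → ℕ,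
        (∀ (m : ℕ) (ω : ℕ → Site 2) (n : ℕ) (υ : ℕ → Site 2), tOf (⟨m, ω⟩, ⟨n, υ⟩) ≤ m) ∧
        (∀ (m : ℕ) (ω : ℕ → Site 2) (n : ℕ) (υ : ℕ → Site 2),
          ∀ i < tOf (⟨m, ω⟩, ⟨n, υ⟩), ∀ j ≤ n, ω i ≠ e₁ + υ j) ∧
        (∀ (m : ℕ) (ω : ℕ → Site 2) (n : ℕ) (υ : ℕ → Site 2), m ≤ tOf (⟨m, ω⟩, ⟨n, υ⟩) ∨
          ∃ j ≤ n, ω (tOf (⟨m, ω⟩, ⟨n, υ⟩)) = e₁ + υ j) := by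
    refine ⟨fun z => Nat.find (⟨z.1.1, Or.inl le_rfl⟩ :
        ∃ i, z.1.1 ≤ i ∨ ∃ j ≤ z.2.1, z.1.2 i = e₁ + z.2.2 j),
      fun m ω n υ => Nat.find_min' _ (Or.inl (le_refl m)), fun m ω n υ i hi j hj hij => ?_,
      fun m ω n υ => Nat.find_spec (⟨m, Or.inl le_rfl⟩ : ∃ i, m ≤ i ∨ ∃ j ≤ n, ω i = e₁ + υ j)⟩
    exact Nat.find_min _ hi (Or.inr ⟨j, hj, hij⟩)
  -- the index `s` on the second walk of the hitting point
  obtain ⟨sOf, hs_le, hs_spec⟩ :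
      ∃ sOf : (Σ _ : ℕ, (ℕ → Site 2)) × (Σ _ : ℕ, (ℕ → Site 2)) → ℕ,
        (∀ (m : ℕ) (ω : ℕ → Site 2) (n : ℕ) (υ : ℕ → Site 2), sOf (⟨m, ω⟩, ⟨n, υ⟩) ≤ n) ∧
        (∀ (m : ℕ) (ω : ℕ → Site 2) (n : ℕ) (υ : ℕ → Site 2),
          (∃ j ≤ n, ω (tOf (⟨m, ω⟩, ⟨n, υ⟩)) = e₁ + υ j) →
            ω (tOf (⟨m, ω⟩, ⟨n, υ⟩)) = e₁ + υ (sOf (⟨m, ω⟩, ⟨n, υ⟩))) := by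
    refine ⟨fun z => if h : ∃ j ≤ z.2.1, z.1.2 (tOf z) = e₁ + z.2.2 j then Classical.choose h else 0,
      fun m ω n υ => ?_, fun m ω n υ h => ?_⟩
    · show (if h : ∃ j ≤ n, ω (tOf (⟨m, ω⟩, ⟨n, υ⟩)) = e₁ + υ j then Classical.choose h else 0) ≤ n
      split_ifs with h
      · exact (Classical.choose_spec h).1
      · exact Nat.zero_le n
    · show ω (tOf (⟨m, ω⟩, ⟨n, υ⟩)) = e₁ +
        υ (if h : ∃ j ≤ n, ω (tOf (⟨m, ω⟩, ⟨n, υ⟩)) = e₁ + υ j then Classical.choose h else 0)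
      rw [dif_pos h]
      exact (Classical.choose_spec h).2
  refine lasso_bound hP hQ M N tOf sOf ht_le hs_le (fun m ω n υ hω hυ => hs_spec m ω n υ ?_) hmin
  rcases hspec m ω n υ with h | h
  · refine ⟨0, Nat.zero_le n, ?_⟩
    rw [le_antisymm (ht_le m ω n υ) h, (Zd.mem_sawFun.1 hω).2.1 m le_rfl, (Zd.mem_sawFun.1 hυ).1,
      add_zero]
  · exact h

end Summit.CriticalPhenomena.SAWScalingLimit.Theorems.TubeLowerBound.LassoRepair

end
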